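import Summits.Ventures.PercRepro.RankLevelSetBiIndepAbsorbPaving

/-! # RankLevelSetBiIndepAbsorbPavingStable — EVERY PAVING MATROID SATISFIES (STABLE) AND THE PARALLEL-PAIR
ONE-CIRCUIT BALANCE (night-1 g32; dossier §44.6)

The contraction `M ／ {y}` of a paving matroid by a non-loop is paving (a set of fewer than `rank − 1` elements
avoiding `y` becomes, with `y`, a set of fewer than `rank` elements; **`paving_contract`**), so it satisfies Mono
(g25's `biIndepMono_of_paving`), and `RankLevelSetBiIndepAbsorbNormSkew` turns (ABS-norm) of `M`
(`absorbNormSkew_of_paving`) into g31's (STABLE) at every element (**`biIndepStable_of_paving`**) and into the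
parallel-pair one-circuit balance `NormSkew (2·shift₁ D(M ／ {y}) + b^y) #E` at every non-loop
(**`parallel_balance_of_paving`**) — the first proved class of both. Every declaration has a docstring; imports: the
cell's own modules and Mathlib only. Axioms: standard. -/

namespace PercRepro

open Set Matroid

variable {α : Type} (M : Matroid α) [M.Finite]

omit [M.Finite] in
/-- **The contraction of a paving matroid by a non-loop is paving**: `rank (M ／ {y}) = rank M − 1`, and a set `I`
avoiding `y` with `#I < rank M − 1` has `#(insert y I) < rank M`, so `insert y I` is independent in `M`. -/
theorem paving_contract (h : Paving M) {y : α} (hy : M.IsNonloop y) : Paving (M.contract {y}) := by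
  intro I hI hlt
  obtain ⟨B', hB'⟩ := (M.contract {y}).exists_isBase
  have hBase : M.IsBase (B' ∪ {y}) ∧ Disjoint B' {y} := (hy.indep.contract_isBase_iff).mp hB'
  have hyB' : y ∉ B' := fun hyB => (Set.disjoint_right.mp hBase.2 (Set.mem_singleton y)) hyB
  have hrank : M.eRank = (M.contract {y}).eRank + 1 := by
    rw [← hBase.1.encard_eq_eRank, ← hB'.encard_eq_eRank, Set.union_singleton,
      Set.encard_insert_of_notMem hyB']
  rw [Matroid.contract_ground] at hI
  have hyI : y ∉ I := fun hyI => (hI hyI).2 rfl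
  rw [hy.contractElem_indep_iff]
  refine ⟨hyI, h _ (Set.insert_subset hy.mem_ground (hI.trans Set.sdiff_subset)) ?_⟩
  rw [Set.encard_insert_of_notMem hyI, hrank]
  exact (ENat.add_lt_add_iff_right (by simp)).mpr hlt

/-- **EVERY PAVING MATROID SATISFIES (STABLE)** at every element (loops vacuously). -/
theorem biIndepStable_of_paving (h : Paving M) : BiIndepStable M := by
  intro y hy
  by_cases hind : M.Indep {y}
  · have hy' : M.IsNonloop y := Matroid.indep_singleton.mp hind
    haveI : (M.contract {y}).Finite :=
      ⟨M.ground_finite.subset (by rw [Matroid.contract_ground]; exact Set.sdiff_subset)⟩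
    exact stableCount_normSkew M hy' (absorbNormSkew_of_paving M h y hy)
      (biIndepMono_of_paving _ (paving_contract M h hy'))
  · exact SkewConv.normSkew_congr (SkewConv.normSkew_zero _) fun k _ =>
      (stableCount_eq_zero_of_loop M hind k).symm

/-- **THE PARALLEL-PAIR ONE-CIRCUIT BALANCE HOLDS ON EVERY PAVING MATROID** at every non-loop `y`:
`NormSkew (2·shift₁ D(M ／ {y}) + b^y) #E`. -/
theorem parallel_balance_of_paving (h : Paving M) {y : α} (hy : M.IsNonloop y) :
    haveI : (M.contract {y}).Finite :=
      ⟨M.ground_finite.subset (by rw [Matroid.contract_ground]; exact Set.sdiff_subset)⟩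
    SkewConv.NormSkew
      (fun k => 2 * SkewConv.shiftSeq (biIndepCount (M.contract {y})) 1 k + yAvoidCount M y k) M.E.ncard := by
  haveI : (M.contract {y}).Finite :=
    ⟨M.ground_finite.subset (by rw [Matroid.contract_ground]; exact Set.sdiff_subset)⟩
  exact parallel_balance_of_absorbNormSkew M hy (absorbNormSkew_of_paving M h y hy.mem_ground)
    (biIndepMono_of_paving _ (paving_contract M h hy))

end PercRepro
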